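import Summits.HubbardSuperconductivity.HubbardSuperconductivity.Theorems.BalabanIRBirEveryGroundState
import Summits.HubbardSuperconductivity.HubbardSuperconductivity.Theorems.BalabanIRBirEveryGroundStateSchur
import Literature.MathematicalPhysics.QuantumLattice.HubbardWave0RepulsiveProofs
import Literature.MathematicalPhysics.QuantumLattice.PairFieldMomentum

/-!
# Route `BalabanIR`, crux 5 `BirEveryGroundState` (item `stmt-HubbardSuperconductivity-2083`): the crux from irreducible ground multiplets, and from the κ-chord

Compositions of the two companion files (`BalabanIRBirEveryGroundState.lean`: the reduction to
scalar ground compressions / to every-ground-state bounds; `BalabanIRBirEveryGroundStateSchur.lean`: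
Schur's lemma and the chord inequality) into two closed-modulo forms of the crux, one per
mechanism proposed for average → every:

* `mulVec_mem_groundEigenspace_of_commute` — a matrix commuting with the Hamiltonian `H`, the
  particle number `N̂` and `S^z` maps the sector ground eigenspace
  `E₀ = szSector N M ⊓ ker (H - e₀)`, `e₀ = minEnergyOn H (szSector N M)`, into itself;
* `conjTranspose_mem_symmetries` — the family of matrices commuting with `H`, `N̂`, `S^z` and the
  `d`-wave pair structure factor `Y = Δ_d† Δ_d` is closed under `ᴴ` (all four are Hermitian);
* `birEveryGroundState_of_irreducibleGround` — **`BirEveryGroundState` holds as soon as, for every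
  `δ ∈ (0, 1/2)`, the couplings `U` at which the sector ground eigenspace `E₀(U, L)` of
  `hubbardTorus 2 L 1 U` is, eventually in even `L`, IRREDUCIBLE under the joint commutant
  `{X | [X, H] = [X, N̂] = [X, S^z] = [X, Δ_d† Δ_d] = 0}` meet every open window `(U₁, U₂) ⊂ (0, ∞)`.**
  (Irreducible ⇒ `Δ_d† Δ_d` has scalar matrix elements on `E₀` by Schur ⇒ every ground state
  carries the average ⇒ the crux, by `birEveryGroundState_of_scalarOnGround`.) The joint commutant
  contains the lattice translations, the point group `D₄`, the spin rotations and time reversal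
  composed with any of these, so irreducibility under it is WEAKER than irreducibility under the
  geometric symmetry group `G_L` of the planner's sketch; it is the residual open claim of the crux.
* `birEveryGroundState_of_kappaChord` — **`BirEveryGroundState` holds as soon as the window-average
  hypothesis yields ONE coupling `U` of the window with a κ-CHORD bound**: `κ a ≤
  minEnergyOn (H + κ L⁻⁴ Δ_d† Δ_d) S - minEnergyOn H S` eventually in even `L`, for some fixed
  `κ, a > 0` (card `kappa-chord-transfer`: a mesoscopic pair penalty raises the sector ground
  energy by an `L`-independent amount). By the chord inequality every sector ground state then has
  `a L⁴ ≤ ⟨ψ, Δ_d† Δ_d ψ⟩`, and `birEveryGroundState_of_everyGroundState_transfer` concludes. The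
  chord bound is NOT proved here (it is the engine's burden in that line).
* `birEveryGroundState_of_simpleGround` — the special case of NON-DEGENERATE sector ground states
  at a dense set of couplings (`dim E₀(U, L) = 1` eventually in even `L`): a line is scalar
  (`exists_scalar_matrixElements_of_finrank_eq_one`).

Serre, *Linear Representations of Finite Groups* §2.2; Kato (1966) II §6.1; Tasaki (2020) §9.3.
Everything proved here is folklore; no definition is introduced.
-/

noncomputable section

namespace Summit.HubbardSuperconductivity.HubbardSuperconductivity.Theorems

open Matrix Finset Filter
open Literature.Probability.LatticeModels Literature.MathematicalPhysics.QuantumLattice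
open Summit.HubbardSuperconductivity.HubbardSuperconductivity.Theses.BalabanIR
open scoped ComplexOrder

/-- **Symmetries preserve the sector ground eigenspace.** On the Fock space of the torus of side
`L`, a matrix `X` commuting with `H`, with the particle number `N̂` and with `S^z` maps
`E₀ = szSector N M ⊓ ker (H - e₀)` (`e₀ = minEnergyOn H (szSector N M)`) into itself: it preserves
`N̂`- and `S^z`-eigenvectors (`isNParticle_iff_totalNumber`, `mem_szSector_iff`) and
`H`-eigenvectors. Tasaki (2020) §9.3.2. [folklore] -/
theorem mulVec_mem_groundEigenspace_of_commute (L : ℕ)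
    (H X : Matrix (Finset (Orb (FermionTorus 2 L))) (Finset (Orb (FermionTorus 2 L))) ℂ)
    (N : ℕ) (M : ℝ) (hH : X * H = H * X) (hN : X * totalNumber = totalNumber * X)
    (hS : X * HubbardWave0.spinZ = HubbardWave0.spinZ * X) {v : Fock (Orb (FermionTorus 2 L))}
    (hv : v ∈ szSector N M ⊓
      Module.End.eigenspace (Matrix.toLin' H) ((H.minEnergyOn (szSector N M) : ℝ) : ℂ)) :
    X *ᵥ v ∈ szSector N M ⊓
      Module.End.eigenspace (Matrix.toLin' H) ((H.minEnergyOn (szSector N M) : ℝ) : ℂ) := by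
  obtain ⟨hvS, hvE⟩ := Submodule.mem_inf.mp hv
  rw [mem_szSector_iff, LiebTwo.isNParticle_iff_totalNumber] at hvS
  rw [Module.End.mem_eigenspace_iff, Matrix.toLin'_apply] at hvE
  refine Submodule.mem_inf.mpr ⟨?_, ?_⟩
  · rw [mem_szSector_iff, LiebTwo.isNParticle_iff_totalNumber]
    refine ⟨?_, ?_⟩
    · rw [mulVec_mulVec, ← hN, ← mulVec_mulVec, hvS.1, mulVec_smul]
    · rw [mulVec_mulVec, ← hS, ← mulVec_mulVec, hvS.2, mulVec_smul]
  · rw [Module.End.mem_eigenspace_iff, Matrix.toLin'_apply, mulVec_mulVec, ← hH, ← mulVec_mulVec,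
      hvE, mulVec_smul]

/-- **The joint commutant of `H`, `N̂`, `S^z`, `Δ_g† Δ_g` is `ᴴ`-closed** (the torus Hubbard
Hamiltonian, the particle number, `S^z` and `Δ_g† Δ_g` are Hermitian, and `X A = A X` for
Hermitian `A` gives `Xᴴ A = A Xᴴ`). Lieb, PRL 62 (1989) 1201, eq. (1); Tasaki (2020) §9.3.
[folklore] -/
theorem conjTranspose_mem_symmetries (L : ℕ) (t U : ℝ) (g : Site 2 → ℝ) [NeZero L]
    {X : Matrix (Finset (Orb (FermionTorus 2 L))) (Finset (Orb (FermionTorus 2 L))) ℂ}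
    (hH : X * hubbardTorus 2 L t U = hubbardTorus 2 L t U * X)
    (hN : X * totalNumber = totalNumber * X)
    (hS : X * HubbardWave0.spinZ = HubbardWave0.spinZ * X)
    (hY : X * ((pairField g L)ᴴ * pairField g L) = (pairField g L)ᴴ * pairField g L * X) :
    Xᴴ * hubbardTorus 2 L t U = hubbardTorus 2 L t U * Xᴴ ∧
      Xᴴ * totalNumber = totalNumber * Xᴴ ∧
      Xᴴ * HubbardWave0.spinZ = HubbardWave0.spinZ * Xᴴ ∧
      Xᴴ * ((pairField g L)ᴴ * pairField g L) = (pairField g L)ᴴ * pairField g L * Xᴴ :=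
  ⟨conjTranspose_commute_of_commute (LiebThm1.hamiltonian_isHermitian _ t U) hH,
    conjTranspose_commute_of_commute totalNumber_isHermitian hN,
    conjTranspose_commute_of_commute HubbardWave0.spinZ_isHermitian hS,
    conjTranspose_commute_of_commute (isHermitian_conjTranspose_mul_self _) hY⟩

/-- **`BirEveryGroundState` from irreducible ground multiplets at a dense set of couplings.**
Suppose that for every `δ ∈ (0, 1/2)` and every open window `(U₁, U₂) ⊂ (0, ∞)` there is a
coupling `U` in the window such that, eventually in even `L`, the sector ground eigenspace
`E₀(U, L) = szSector N_L 0 ⊓ ker (H - e₀)` of `H = hubbardTorus 2 L 1 U` has no subspace other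
than `⊥` and itself invariant under every matrix `X` commuting with `H`, `N̂`, `S^z` and
`Y = Δ_d† Δ_d` (irreducibility under the joint commutant — it contains translations, `D₄`, spin
rotations). Then `BirEveryGroundState` holds: by Schur
(`exists_scalar_matrixElements_of_irreducible`, the commutant preserves `E₀` by
`mulVec_mem_groundEigenspace_of_commute` and is `ᴴ`-closed by `conjTranspose_mem_symmetries`) the
matrix elements of `Y` on `E₀(U, L)` are scalar, and `birEveryGroundState_of_scalarOnGround`
applies. The irreducibility hypothesis is the residual open claim of the crux (no theorem of this
kind is known for Hubbard tori); this is the crux closed modulo it.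
Serre §2.2; Kato (1966) II §6.1. [folklore] -/
theorem birEveryGroundState_of_irreducibleGround
    (hirr : ∀ δ ∈ Set.Ioo (0:ℝ) (1/2), ∀ U₁ U₂ : ℝ, 0 < U₁ → U₁ < U₂ →
      ∃ U ∈ Set.Ioo U₁ U₂, ∃ L₀ : ℕ, ∀ (L : ℕ) [NeZero L], L₀ ≤ L → Even L →
        let N : ℕ := 2 * ⌊(1 - δ) * (L : ℝ) ^ 2 / 2⌋₊
        let H := hubbardTorus 2 L 1 U
        let S := szSector (Λ := FermionTorus 2 L) N 0
        let E₀ := S ⊓ Module.End.eigenspace (Matrix.toLin' H) ((H.minEnergyOn S : ℝ) : ℂ)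
        let Y : Matrix (Finset (Orb (FermionTorus 2 L))) (Finset (Orb (FermionTorus 2 L))) ℂ :=
          (pairField dWaveFormFactor L)ᴴ * pairField dWaveFormFactor L
        ∀ K' : Submodule ℂ (Fock (Orb (FermionTorus 2 L))), K' ≤ E₀ →
          (∀ X : Matrix (Finset (Orb (FermionTorus 2 L))) (Finset (Orb (FermionTorus 2 L))) ℂ,
            X * H = H * X → X * totalNumber = totalNumber * X →
            X * HubbardWave0.spinZ = HubbardWave0.spinZ * X → X * Y = Y * X →
            ∀ v ∈ K', X *ᵥ v ∈ K') →
          K' = ⊥ ∨ K' = E₀) :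
    BirEveryGroundState := by
  refine birEveryGroundState_of_scalarOnGround fun δ hδ U₁ U₂ hU₁ hU₁₂ => ?_
  obtain ⟨U, hU, L₀, hL₀⟩ := hirr δ hδ U₁ U₂ hU₁ hU₁₂
  refine ⟨U, hU, L₀, fun L _ hL hLe => ?_⟩
  have hirrL := hL₀ L hL hLe
  simp only at hirrL ⊢
  -- name the objects of side `L`
  set Y : Matrix (Finset (Orb (FermionTorus 2 L))) (Finset (Orb (FermionTorus 2 L))) ℂ :=
    (pairField dWaveFormFactor L)ᴴ * pairField dWaveFormFactor L with hY
  set H := hubbardTorus 2 L 1 U with hH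
  set Sec := szSector (Λ := FermionTorus 2 L) (2 * ⌊(1 - δ) * (L : ℝ) ^ 2 / 2⌋₊) 0 with hSec
  set E₀ := Sec ⊓ Module.End.eigenspace (Matrix.toLin' H) ((H.minEnergyOn Sec : ℝ) : ℂ) with hE₀
  -- the joint commutant
  let Sym : Set (Matrix (Finset (Orb (FermionTorus 2 L))) (Finset (Orb (FermionTorus 2 L))) ℂ) :=
    {X | X * H = H * X ∧ X * totalNumber = totalNumber * X ∧
      X * HubbardWave0.spinZ = HubbardWave0.spinZ * X ∧ X * Y = Y * X}
  have hSA : ∀ X ∈ Sym, X * Y = Y * X := fun X hX => hX.2.2.2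
  have hSK : ∀ X ∈ Sym, ∀ v ∈ E₀, X *ᵥ v ∈ E₀ := fun X hX v hv =>
    mulVec_mem_groundEigenspace_of_commute L H X _ 0 hX.1 hX.2.1 hX.2.2.1 hv
  have hSK' : ∀ X ∈ Sym, ∀ v ∈ E₀, Xᴴ *ᵥ v ∈ E₀ := by
    intro X hX v hv
    obtain ⟨h1, h2, h3, -⟩ := conjTranspose_mem_symmetries L 1 U dWaveFormFactor
      hX.1 hX.2.1 hX.2.2.1 hX.2.2.2
    exact mulVec_mem_groundEigenspace_of_commute L H Xᴴ _ 0 h1 h2 h3 hv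
  have hirr' : ∀ K' : Submodule ℂ (Fock (Orb (FermionTorus 2 L))), K' ≤ E₀ →
      (∀ X ∈ Sym, ∀ v ∈ K', X *ᵥ v ∈ K') → K' = ⊥ ∨ K' = E₀ := fun K' hK' hinv =>
    hirrL K' hK' fun X h1 h2 h3 h4 v hv => hinv X ⟨h1, h2, h3, h4⟩ v hv
  exact exists_scalar_matrixElements_of_irreducible E₀ Y Sym hSA hSK hSK' hirr'


/-- **`BirEveryGroundState` from a κ-chord bound at one coupling of the window** (card
`kappa-chord-transfer`, composition). Suppose that for all data `(δ, U₁, U₂, c)` the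
window-average hypothesis of the crux yields a coupling `U ∈ (U₁, U₂)` and constants `κ, a > 0`
with, eventually in even `L`, `κ a ≤ minEnergyOn (H + κ Y_L) S_L - minEnergyOn H S_L` for
`H = hubbardTorus 2 L 1 U`, `S_L = szSector N_L 0` and the normalised structure factor
`Y_L = L⁻⁴ Δ_d† Δ_d`. Then `BirEveryGroundState`: by the chord inequality
(`chord_div_le_re_expect_of_eigen`) every normalised sector ground state `ψ` has
`a ≤ (minEnergyOn (H + κ Y_L) S_L - minEnergyOn H S_L) / κ ≤ ⟨ψ, Y_L ψ⟩ = L⁻⁴ ⟨ψ, Δ_d† Δ_d ψ⟩`,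
i.e. the every-ground-state bound with constant `a`, and
`birEveryGroundState_of_everyGroundState_transfer` applies. The chord bound itself is not proved
here (the crux closed modulo it). [folklore] -/
theorem birEveryGroundState_of_kappaChord
    (hchord : ∀ (δ U₁ U₂ c : ℝ), δ ∈ Set.Ioo (0:ℝ) (1/2) → 0 < U₁ → U₁ < U₂ → 0 < c →
      (∀ U ∈ Set.Ioo U₁ U₂, ∃ L₀ : ℕ, ∀ (L : ℕ) [NeZero L], L₀ ≤ L → Even L →
        let N : ℕ := 2 * ⌊(1 - δ) * (L : ℝ) ^ 2 / 2⌋₊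
        let H := hubbardTorus 2 L 1 U
        let S := szSector (Λ := FermionTorus 2 L) N 0
        let E₀ := S ⊓ Module.End.eigenspace (Matrix.toLin' H) ((H.minEnergyOn S : ℝ) : ℂ)
        let P := projMatrix (E₀.map (Fock.toEuclidean (ι := Orb (FermionTorus 2 L)) :
          Fock (Orb (FermionTorus 2 L)) →ₗ[ℂ] EuclideanSpace ℂ (Finset (Orb (FermionTorus 2 L)))))
        c * (L : ℝ) ^ 4 * P.trace.re ≤
          (P * ((pairField dWaveFormFactor L)ᴴ * pairField dWaveFormFactor L)).trace.re) →
      ∃ U ∈ Set.Ioo U₁ U₂, ∃ κ a : ℝ, 0 < κ ∧ 0 < a ∧ ∃ L₀ : ℕ, ∀ (L : ℕ) [NeZero L],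
        L₀ ≤ L → Even L →
        let N : ℕ := 2 * ⌊(1 - δ) * (L : ℝ) ^ 2 / 2⌋₊
        let H := hubbardTorus 2 L 1 U
        let S := szSector (Λ := FermionTorus 2 L) N 0
        let Yd : Matrix (Finset (Orb (FermionTorus 2 L))) (Finset (Orb (FermionTorus 2 L))) ℂ :=
          ((1 : ℂ) / (L : ℂ) ^ 4) •
            ((pairField dWaveFormFactor L)ᴴ * pairField dWaveFormFactor L)
        κ * a ≤ (H + (κ : ℂ) • Yd).minEnergyOn S - H.minEnergyOn S) :
    BirEveryGroundState := by
  refine birEveryGroundState_of_everyGroundState_transfer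
    fun δ U₁ U₂ c hδ hU₁ hU₁₂ hc hyp => ?_
  obtain ⟨U, hU, κ, a, hκ, ha, L₀, hL₀⟩ := hchord δ U₁ U₂ c hδ hU₁ hU₁₂ hc hyp
  refine ⟨U, hU, a, ha, L₀, fun L _ hL hLe ψ hgs hunit => ?_⟩
  have hgap := hL₀ L hL hLe
  simp only at hgap
  -- name the objects of side `L`
  set A : Matrix (Finset (Orb (FermionTorus 2 L))) (Finset (Orb (FermionTorus 2 L))) ℂ :=
    (pairField dWaveFormFactor L)ᴴ * pairField dWaveFormFactor L with hA
  set H := hubbardTorus 2 L 1 U with hH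
  set S := szSector (Λ := FermionTorus 2 L) (2 * ⌊(1 - δ) * (L : ℝ) ^ 2 / 2⌋₊) 0 with hS
  set Yd : Matrix (Finset (Orb (FermionTorus 2 L))) (Finset (Orb (FermionTorus 2 L))) ℂ :=
    ((1 : ℂ) / (L : ℂ) ^ 4) • A with hYd
  -- the chord inequality for the ground state `ψ`
  have hch := chord_div_le_re_expect_of_eigen H Yd S hκ hgs.1 hunit hgs.2.2
  have hL4 : (0 : ℝ) < (L : ℝ) ^ 4 := by
    have : (0 : ℝ) < (L : ℝ) := Nat.cast_pos.mpr (Nat.pos_of_ne_zero (NeZero.ne L))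
    positivity
  -- `⟨ψ, Y_L ψ⟩ = L⁻⁴ ⟨ψ, Δ_d† Δ_d ψ⟩`
  have hexp : (star ψ ⬝ᵥ Yd *ᵥ ψ).re = (star ψ ⬝ᵥ A *ᵥ ψ).re / (L : ℝ) ^ 4 := by
    have hcast : ((1 : ℂ) / (L : ℂ) ^ 4) = (((1 : ℝ) / (L : ℝ) ^ 4 : ℝ) : ℂ) := by push_cast; ring
    rw [hYd, smul_mulVec, dotProduct_smul, smul_eq_mul, hcast, Complex.re_ofReal_mul]
    ring
  have ha' : a ≤ ((H + (κ : ℂ) • Yd).minEnergyOn S - H.minEnergyOn S) / κ := by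
    rw [le_div_iff₀ hκ, mul_comm]
    exact hgap
  have key : a ≤ (star ψ ⬝ᵥ A *ᵥ ψ).re / (L : ℝ) ^ 4 := by
    rw [← hexp]
    exact ha'.trans hch
  rwa [le_div_iff₀ hL4] at key


/-- **Lines are scalar.** If `dim K = 1`, the matrix elements of ANY matrix `A` on `K` are those of
a scalar: `⟨w, A v⟩ = μ ⟨w, v⟩` for `v, w ∈ K` (`μ = ⟨u, A u⟩ / ⟨u, u⟩` for a spanning vector `u`).
[folklore] -/
theorem exists_scalar_matrixElements_of_finrank_eq_one {n : Type*} [Fintype n]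
    (K : Submodule ℂ (n → ℂ)) (hK : Module.finrank ℂ K = 1) (A : Matrix n n ℂ) :
    ∃ μ : ℂ, ∀ v ∈ K, ∀ w ∈ K, star w ⬝ᵥ A *ᵥ v = μ * (star w ⬝ᵥ v) := by
  obtain ⟨u, hu0, hspan⟩ := finrank_eq_one_iff'.mp hK
  have hu0' : (u : n → ℂ) ≠ 0 := fun h => hu0 (Subtype.ext h)
  have huu : star (u : n → ℂ) ⬝ᵥ (u : n → ℂ) ≠ 0 :=
    fun h => hu0' (dotProduct_star_self_eq_zero.mp h)
  refine ⟨(star (u : n → ℂ) ⬝ᵥ A *ᵥ (u : n → ℂ)) / (star (u : n → ℂ) ⬝ᵥ (u : n → ℂ)),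
    fun v hv w hw => ?_⟩
  obtain ⟨a, ha⟩ := hspan ⟨v, hv⟩
  obtain ⟨b, hb⟩ := hspan ⟨w, hw⟩
  have ha' : v = a • (u : n → ℂ) := by
    have := congrArg Subtype.val ha
    simpa using this.symm
  have hb' : w = b • (u : n → ℂ) := by
    have := congrArg Subtype.val hb
    simpa using this.symm
  rw [ha', hb', mulVec_smul, star_smul, smul_dotProduct, smul_dotProduct, dotProduct_smul,
    dotProduct_smul, smul_eq_mul, smul_eq_mul, smul_eq_mul, smul_eq_mul]
  field_simp

/-- **`BirEveryGroundState` from SIMPLE sector ground states at a dense set of couplings.** If for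
every `δ ∈ (0, 1/2)` and every open window `(U₁, U₂) ⊂ (0, ∞)` some coupling `U` of the window has,
eventually in even `L`, a NON-DEGENERATE ground state of `hubbardTorus 2 L 1 U` in the sector
`(2⌊(1-δ)L²/2⌋, S^z = 0)` (`dim E₀(U, L) = 1`), then `BirEveryGroundState` (a line is scalar,
`exists_scalar_matrixElements_of_finrank_eq_one`, then `birEveryGroundState_of_scalarOnGround`).
Ground-state uniqueness at generic coupling is the strongest (and most studied) form of the
genericity bet; it is NOT proved here. [folklore] -/
theorem birEveryGroundState_of_simpleGround
    (hsimple : ∀ δ ∈ Set.Ioo (0:ℝ) (1/2), ∀ U₁ U₂ : ℝ, 0 < U₁ → U₁ < U₂ →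
      ∃ U ∈ Set.Ioo U₁ U₂, ∃ L₀ : ℕ, ∀ (L : ℕ) [NeZero L], L₀ ≤ L → Even L →
        let N : ℕ := 2 * ⌊(1 - δ) * (L : ℝ) ^ 2 / 2⌋₊
        let H := hubbardTorus 2 L 1 U
        let S := szSector (Λ := FermionTorus 2 L) N 0
        let E₀ := S ⊓ Module.End.eigenspace (Matrix.toLin' H) ((H.minEnergyOn S : ℝ) : ℂ)
        Module.finrank ℂ E₀ = 1) :
    BirEveryGroundState := by
  refine birEveryGroundState_of_scalarOnGround fun δ hδ U₁ U₂ hU₁ hU₁₂ => ?_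
  obtain ⟨U, hU, L₀, hL₀⟩ := hsimple δ hδ U₁ U₂ hU₁ hU₁₂
  refine ⟨U, hU, L₀, fun L _ hL hLe => ?_⟩
  have h1 := hL₀ L hL hLe
  simp only at h1 ⊢
  exact exists_scalar_matrixElements_of_finrank_eq_one _ h1 _

end Summit.HubbardSuperconductivity.HubbardSuperconductivity.Theorems
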